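import Summits.BirchSwinnertonDyer.BirchSwinnertonDyer.Theorems.ByReductionTypeAtTwoOrdKatoHalfAtTwoIsoZetaColemanMuIotaKatoCarriers
import Summits.BirchSwinnertonDyer.BirchSwinnertonDyer.Theorems.ByReductionTypeAtTwoOrdKatoHalfAtTwoIsoPosDiscEpsilonDefs
import HarnessLib

/-!
# Route ByReductionTypeAtTwo, crux `OrdKatoHalfAtTwoIso` (stmt-BirchSwinnertonDyer-19573), line `steinberg-fibre-at-two`,
# P⁺ slot (`0 < Δ` half of child stmt-BirchSwinnertonDyer-24097): the SPAN-FREE ι-keyed Coleman `μ`-package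
# `ColemanMuSpanFreeIotaPosDiscAtTwo` (P⁺, p699544) BY NAME from TWO typed inputs on KATO'S CARRIERS — the SAME classical
# input (W1+W3) as w3's F1μι⁻ door `zetaColemanMuIotaNegDiscAtTwo_of_katoCarriers` (p720644), and (W2⁺) «a Coleman map at
# `2` with ordinary kernel and ONE global class with a `μ`-free value on `0 < Δ`» (the half-class reading, triage Thm E/F)

Seat `cruxlead-stmt-BirchSwinnertonDyer-19573` g9 (LEAD PROVER, MODE LINE; HOME `run/shared/lean/pub/bsd-2adic/`; `--supports`
stmt-BirchSwinnertonDyer-19573). THEOREMS ONLY (no definition, no named fact, no `sorry`, no instance). HONEST FRAMING (cell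
bsd-2adic): BSD is not proved by any of this; P⁺, the `0 < Δ` conjunct, the PAIR child 24097 and the crux are NOT proved here; both
inputs are OPEN hypotheses displayed in the signatures (W1+W3 classical at every `p` — Λ-adic Tate local duality at the layers,
`F⁺ ⊥ F⁺`, Poitou–Tate with the real places; W2⁺ the memo-grade reading on the `0 < Δ` cell), NOT definitions, NOT Literature facts.

WHY. In w3's per-datum door `zetaColemanMuTheta_invol_datum_of_adjointPairing_erl` (p699159) the genuineness hypothesis
`hG : ∀ g ∈ G, IsEulerSystemClassTwo …` serves EXACTLY ONE conjunct of the conclusion — the span clause `Z ≤ Λ·{genuine}` —;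
the ι-semilinear transpose `τ`, the fine quotient `π`, exactness, `τ ∘ ℓ = 0` and the image clause at `(2)` come from the pairing,
the Coleman map, reciprocity and the ERL shape alone. P⁺ is F1μι⁻'s body WITHOUT `𝐇¹`/`Z`/`ℓ`/the span clause (lead g6 (ε) text), so
the same construction with ONE coordinate `x₀ ∈ P₀` (print: `loc₂` of the HALF class `y′ = Cor z̃_{γ⁺}/2` of a rectangular period
lattice, triage Thm E/F = lead F-27a ÷ 2) in place of the set `G` proves P⁺ per datum (`P := range col`, `M := Λ·col x₀`). §3
quantifies the two inputs over ALL pinned carriers exactly as p720644: `hpairPT` is p720644's first hypothesis VERBATIM (ONE classical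
statement serves both cells), `hcolHalfPos` is p720644's `hcolERL` with `W.Δ < 0 ↦ 0 < W.Δ` and the genuineness conjunct DROPPED (on
`0 < Δ` no genuine class has a `μ`-free value, p691215; the witness is the half class — a global Iwasawa class, not an Euler-system
class). READING NOTE (honest pricing of W2⁺): the text does not pin `col` to Kato's Coleman map (any rescaling by a nonzero `λ ∈ Λ`
keeps its kernel), so modulo the integral lift of `L₂(f, α)` (INT2-AUTO) W2⁺ SAYS «an ordinary-kernel `Λ`-linear functional on
`𝐇¹_{loc,Γ}(T₂W)` and ONE global class with a `μ`-free value» — under Poitou–Tate a consequence of `μ(X(W/ℚ_∞)) = 0` (Greenberg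
Conj. 1.11 at `2` on the cell) plus the ordinary Coleman functional at `2`; consistent with triage Thm F (`μ(X) = μ(X₀^{str ∞})`).

* §1 `colemanMuSpanFree_invol_datum_of_adjointPairing_erl` — per datum, span-free twin of p699159 §3.
* §2 `colemanMuSpanFree_invol_datum_of_locPairing_erl` — per datum, Selmer side built inside the proof (span-free twin of p700176 §1).
* §3 `colemanMuSpanFreeIotaPosDiscAtTwo_of_katoCarriers` — (W1+W3) ∧ (W2⁺) ⇒ `ColemanMuSpanFreeIotaPosDiscAtTwo` BY NAME.

References: [Kato2004Asterisque] Thm 12.5 (1), 12.6 (pp. 221–222), (14.9.3) (p. 240), Thm 16.6 (2) (p. 271), Lemma 17.9, Prop 17.11,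
Lemma 17.12 (pp. 275–279), §17.13 (pp. 279–280); [MilneADT2006] I Cor. 2.3, I Thm 4.10; [GreenbergLNM1716] §1 p. 60, Conj. 1.11 (p. 64),
§2 (pp. 69–74); [SerreLocalFields1979] VII §5 Prop. 3; tree p690240, p696469, p699159, p700176, p720644 (w3), p699544 (lead g6), p715043.
-- adapted from w3's `…ZetaColemanMuIotaAdjointPairing` §3 / `…IotaLocPairing` §1 / `…IotaKatoCarriers` (span clause removed).
-/

set_option autoImplicit false
set_option linter.dupNamespace false

noncomputable section

open scoped Classical MatrixGroups ModularForm NumberField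
open CongruenceSubgroup WeierstrassCurve Field IsDedekindDomain NumberField
open Literature.NumberTheory.GaloisRepresentations
open Literature.NumberTheory.GaloisCohomology
open Literature.NumberTheory.EllipticCurves Literature.NumberTheory.EllipticCurves.ModularForms
  Literature.NumberTheory.EllipticCurves.GreenbergSelmer
open Literature.NumberTheory.EllipticCurves.Kato2004
  Literature.NumberTheory.EllipticCurves.Kato2004.EulerSystemValues
open Literature.NumberTheory.EllipticCurves.IwasawaDual
open Literature.NumberTheory.EllipticCurves.Rank1Residual
open Literature.NumberTheory.EllipticCurves.Greenberg1999
open Summit.BirchSwinnertonDyer.Rank1Residual Summit.BirchSwinnertonDyer.Rank1Residual.X5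

namespace Summit.BirchSwinnertonDyer.BirchSwinnertonDyer.Theorems.SteinbergFibreAtTwo

/-! ## §1 Per datum: the SPAN-FREE package from an adjoint pairing, an isotropic Coleman map and ONE coordinate `x₀` -/

section PerDatum

variable {W : WeierstrassCurve ℚ} [W.IsElliptic] [W.IsGloballyMinimal] {N : ℕ} {f : CuspForm (Gamma0 N) 2}
  {κ : ZpExtension ℚ 2} {γ : absoluteGaloisGroup ℚ}

/-- **The span-free ι-keyed Coleman `μ`-package, per datum, from the WEAK local inputs at `2` and ONE coordinate.**
Hypotheses (explicit; nothing asserted): a `Λ`-module `P₀` (print: `𝐇¹_{loc,Γ}(T₂W)`), an abelian group `S` with endomorphisms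
`ψ⁻, ψ` (`(1+ψ⁻)(1+ψ) = 1 = (1+ψ)(1+ψ⁻)`), an ADJOINT pairing `toDualP : P₀ → Hom(S, ℚ/ℤ)` (`T ↔ ψ⁻`, constants through
`ℤ₂ → ℤ/2^k`) which is ONTO; a `Λ`-linear `col : P₀ → Λ` whose KERNEL pairs to zero with `φ(Sel)`; `φ : Sel → S` intertwining
`conj_γ − 1` with `ψ`, kernel = `loc₂`-trivial classes; ONE `x₀ ∈ P₀` with (R) `toDualP x₀ (φ s) = 0` on `Sel` and (E) the ERL
shape `col x₀ = u·M·L′`, `M ∉ (2)`, `ι L′ = C r · L₂(f, α)`, `‖r‖₂ = 1`. CONCLUSION: P⁺ per datum (`P := range col`, `M := Λ·col x₀`,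
`τ` the `ι`-semilinear transpose of `φ` descended to `P₀ ⧸ ker col ≅ range col`, `π` the canonical fine quotient). p699159's proof with
the set of genuine classes replaced by `x₀` and the span clause dropped (genuineness served that clause only).
[cite: Kato2004Asterisque, Thm 12.6 (p. 222), (14.9.3) (p. 240), Thm 16.6 (2) (p. 271), Lemma 17.9, Prop 17.11, Lemma 17.12 (pp. 275–279), §17.13 (pp. 279–280)]
[cite: MilneADT2006, Ch. I, Cor. 2.3] [cite: GreenbergLNM1716, §2 (pp. 69–74)] -/
theorem colemanMuSpanFree_invol_datum_of_adjointPairing_erl (D : W.SelmerDualData κ γ) (Y : W.FineSelmerDualData κ γ)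
    {P₀ : Type*} [AddCommGroup P₀] [Module (IwasawaAlgebra 2) P₀] {S : Type*} [AddCommGroup S]
    (ψm ψ : AddMonoid.End S) (hψ₁ : (1 + ψm) * (1 + ψ) = 1) (hψ₂ : (1 + ψ) * (1 + ψm) = 1)
    (toDualP : P₀ →+ (S →+ AddCircle (1 : ℚ)))
    (hT : ∀ (x : P₀) (s : S), toDualP ((PowerSeries.X : IwasawaAlgebra 2) • x) s = toDualP x (ψm s))
    (hC : ∀ (c : ℤ_[2]) (x : P₀) (s : S) (k : ℕ), 2 ^ k • s = 0 →
      toDualP (PowerSeries.C c • x) s = (PadicInt.toZModPow k c).val • toDualP x s)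
    (hsurj : Function.Surjective toDualP)
    (col : P₀ →ₗ[IwasawaAlgebra 2] IwasawaAlgebra 2)
    (φ : W.selmerInfty κ →+ S) (hφ : ∀ s, φ ((W.conjSelmerInfty κ γ - 1) s) = ψ (φ s))
    (hφker : ∀ s : W.selmerInfty κ, φ s = 0 ↔
      ∀ (v : HeightOneSpectrum (𝓞 ℚ)), ((2 : ℕ) : 𝓞 ℚ) ∈ v.asIdeal → ∀ σ : absoluteGaloisGroup ℚ,
        W.conjH1 2 κ.kerSubgroup σ (s : W.subgroupH1 2 κ.kerSubgroup) ∈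
          awayKer κ.kerSubgroup (W.geomPrimaryTorsion 2) v)
    (hcolφ : ∀ x : P₀, col x = 0 → ∀ s : W.selmerInfty κ, toDualP x (φ s) = 0)
    (x₀ : P₀) (hrec : ∀ s : W.selmerInfty κ, toDualP x₀ (φ s) = 0)
    (herl : ∃ (u : (IwasawaAlgebra 2)ˣ) (M L' : IwasawaAlgebra 2) (r : ℚ_[2]),
      M ∉ IwasawaAlgebra.augIdealP 2 ∧ ‖r‖ = 1 ∧
        iwasawaToPowerSeries 2 L' = PowerSeries.C r * padicLFunction f (unitRoot W 2 : ℚ_[2]) ∧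
        col x₀ = (u : IwasawaAlgebra 2) * M * L') :
    ∃ (P : Submodule (IwasawaAlgebra 2) (IwasawaAlgebra 2)) (M : Submodule (IwasawaAlgebra 2) P)
      (τ : P →ₛₗ[((IwasawaAlgebra.involEquiv 2).toRingEquiv : IwasawaAlgebra 2 →+* IwasawaAlgebra 2)] D.X)
      (π : D.X →ₗ[IwasawaAlgebra 2] Y.X),
      (∀ m ∈ M, τ m = 0) ∧ Function.Surjective π ∧ Function.Exact τ π ∧
      ∀ G₁ : IwasawaAlgebra 2,
        iwasawaToPowerSeries 2 G₁ = padicLFunction f (unitRoot W 2 : ℚ_[2]) →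
          ∃ s : IwasawaAlgebra 2, s ∉ IwasawaAlgebra.augIdealP 2 ∧ s * G₁ ∈ Submodule.map P.subtype M := by
  -- the `ι`-semilinear transpose `F : P₀ → X` of `φ = loc₂`, and the canonical fine quotient `π`
  obtain ⟨F, hF⟩ := exists_involSemilinear_transpose_of_adjoint hT hC (D.isDualPair' W κ) ψ hψ₁ hψ₂ φ hφ
  obtain ⟨π, hπs, hπ⟩ := WeierstrassCurve.FineSelmerDualData.exists_linearMap_ofSelmerDual W κ D Y
  have hker' : ∀ s : W.selmerInfty κ,
      φ s = 0 ↔ s ∈ (AddSubgroup.inclusion (W.fineSelmerInfty_le_selmerInfty κ)).range := by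
    intro s
    rw [hker_of_kernel_above_two φ hφker, AddMonoidHom.mem_range]
    constructor
    · intro hs
      exact ⟨⟨(s : W.subgroupH1 2 κ.kerSubgroup), hs⟩, Subtype.ext rfl⟩
    · rintro ⟨s₀, rfl⟩
      exact s₀.2
  have hexact : Function.Exact F π :=
    exact_transpose_of_ker_eq_range D.bijective Y.bijective.1 hsurj
      (AddSubgroup.inclusion (W.fineSelmerInfty_le_selmerInfty κ)) φ hker' hπ hF
  -- reciprocity for the one coordinate: `F x₀ = 0`
  have hx₀ : F x₀ = 0 := transpose_eq_zero_of_pairing_eq_zero D.bijective.1 φ hF hrec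
  -- the transpose descends along `P₀ ↠ P₀ ⧸ ker col ≅ range col` (isotropy of `ker col`)
  have hkerle : LinearMap.ker col ≤ LinearMap.ker F := by
    intro x hx
    rw [LinearMap.mem_ker] at hx ⊢
    exact transpose_eq_zero_of_pairing_eq_zero D.bijective.1 φ hF (hcolφ x hx)
  let τ : LinearMap.range col →ₛₗ[((IwasawaAlgebra.involEquiv 2).toRingEquiv :
      IwasawaAlgebra 2 →+* IwasawaAlgebra 2)] D.X :=
    ((LinearMap.ker col).liftQ F hkerle).comp col.quotKerEquivRange.symm.toLinearMap
  have hτ : ∀ x : P₀, τ (col.rangeRestrict x) = F x := by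
    intro x
    change (LinearMap.ker col).liftQ F hkerle (col.quotKerEquivRange.symm ⟨col x, LinearMap.mem_range_self col x⟩) = F x
    rw [LinearMap.quotKerEquivRange_symm_apply_image, Submodule.mkQ_apply, Submodule.liftQ_apply]
  refine ⟨LinearMap.range col, Submodule.span (IwasawaAlgebra 2) {col.rangeRestrict x₀}, τ, π, ?_, hπs, ?_, ?_⟩
  · -- (b) `τ` kills `M = Λ·col x₀`
    intro m hm
    rw [Submodule.mem_span_singleton] at hm
    obtain ⟨a, rfl⟩ := hm
    rw [LinearMap.map_smulₛₗ, hτ, hx₀, smul_zero]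
  · -- (d) exactness at `X`: `range τ = range F`
    intro x
    refine (hexact x).trans ⟨?_, ?_⟩
    · rintro ⟨u, hu⟩
      exact ⟨col.rangeRestrict u, by rw [hτ]; exact hu⟩
    · rintro ⟨v, hv⟩
      obtain ⟨u, hu⟩ := col.surjective_rangeRestrict v
      exact ⟨u, by rw [← hτ, hu]; exact hv⟩
  · -- (e) the image clause, transported to `range col`, from the ERL shape
    intro G₁ hG₁
    obtain ⟨u, M, L', r, hM, hr, hL', hcol⟩ := herl
    obtain ⟨s, hs, hsx⟩ := exists_not_mem_augIdealP_and_eq_mul_of_erlShape hM hr hL' hG₁ hcol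
    refine ⟨s, hs, ?_⟩
    rw [Submodule.mem_map]
    refine ⟨col.rangeRestrict x₀, Submodule.mem_span_singleton_self _, ?_⟩
    rw [← hsx]
    rfl

/-! ## §2 Per datum: the Selmer side of the weak local input built in the kernel (span-free twin of p700176 §1) -/

/-- **The span-free package, per datum, from a pairing of the local module AGAINST THE GLOBAL CLASSES THROUGH `loc₂` and ONE
coordinate.** Hypotheses (explicit; nothing asserted): a place `v₂ ∋ 2`; a `Λ`-module `P₀` with an additive
`toDualP : P₀ → Hom(H¹(ker κ, E[2^∞]), ℚ/ℤ)` which (K) factors through `loc_{v₂}`, (T) is ADJOINT for `γ ↔ γ⁻¹`, (C) is `ℤ₂`-BILINEAR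
on torsion values, (S) is ONTO the `loc_{v₂}`-characters; a `Λ`-linear `col : P₀ → Λ` whose kernel pairs to zero with `Sel`; ONE
`x₀ ∈ P₀` with (R) `toDualP x₀ s = 0` on `Sel` and (E) the ERL shape. CONSTRUCTION (inside the proof, verbatim p700176 §1):
`S := H¹(ker κ, E[2^∞]) ⧸ ker res_{v₂}` (`conj`-stable: ONE prime of `ℚ_∞` above `2`, p690240), keys `conj_{γ^{±1}} − 1` descended,
`φ := (mod) ∘ (Sel ↪ H¹)`, the descended pairing; then §1 with p690240's kernel description at one place.
[cite: Kato2004Asterisque, (14.9.3) (p. 240), Prop 17.11, Lemma 17.12 (pp. 277–279), §17.13 (pp. 279–280)]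
[cite: MilneADT2006, Ch. I, Cor. 2.3] [cite: GreenbergLNM1716, §2 (p. 72)] [cite: SerreLocalFields1979, VII §5 Prop. 3] -/
theorem colemanMuSpanFree_invol_datum_of_locPairing_erl (hκ : κ.IsCyclotomic)
    (D : W.SelmerDualData κ γ) (Y : W.FineSelmerDualData κ γ)
    (v₂ : HeightOneSpectrum (𝓞 ℚ)) (hv₂ : ((2 : ℕ) : 𝓞 ℚ) ∈ v₂.asIdeal)
    {P₀ : Type*} [AddCommGroup P₀] [Module (IwasawaAlgebra 2) P₀]
    (toDualP : P₀ →+ (W.subgroupH1 2 κ.kerSubgroup →+ AddCircle (1 : ℚ)))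
    (hK : ∀ (x : P₀) (s : W.subgroupH1 2 κ.kerSubgroup),
      W.resOfLe 2 (inf_le_left : κ.kerSubgroup ⊓ decomp v₂ ≤ κ.kerSubgroup) s = 0 → toDualP x s = 0)
    (hT : ∀ (x : P₀) (s : W.subgroupH1 2 κ.kerSubgroup),
      toDualP ((PowerSeries.X : IwasawaAlgebra 2) • x) s = toDualP x (W.conjH1 2 κ.kerSubgroup γ⁻¹ s) - toDualP x s)
    (hC : ∀ (c : ℤ_[2]) (x : P₀) (s : W.subgroupH1 2 κ.kerSubgroup) (k : ℕ), 2 ^ k • toDualP x s = 0 →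
      toDualP (PowerSeries.C c • x) s = (PadicInt.toZModPow k c).val • toDualP x s)
    (hS : ∀ χ : W.subgroupH1 2 κ.kerSubgroup →+ AddCircle (1 : ℚ),
      (∀ s, W.resOfLe 2 (inf_le_left : κ.kerSubgroup ⊓ decomp v₂ ≤ κ.kerSubgroup) s = 0 → χ s = 0) →
        ∃ x : P₀, toDualP x = χ)
    (col : P₀ →ₗ[IwasawaAlgebra 2] IwasawaAlgebra 2)
    (hcolφ : ∀ x : P₀, col x = 0 → ∀ s : W.selmerInfty κ, toDualP x s = 0)
    (x₀ : P₀) (hrec : ∀ s : W.selmerInfty κ, toDualP x₀ s = 0)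
    (herl : ∃ (u : (IwasawaAlgebra 2)ˣ) (M L' : IwasawaAlgebra 2) (r : ℚ_[2]),
      M ∉ IwasawaAlgebra.augIdealP 2 ∧ ‖r‖ = 1 ∧
        iwasawaToPowerSeries 2 L' = PowerSeries.C r * padicLFunction f (unitRoot W 2 : ℚ_[2]) ∧
        col x₀ = (u : IwasawaAlgebra 2) * M * L') :
    ∃ (P : Submodule (IwasawaAlgebra 2) (IwasawaAlgebra 2)) (M : Submodule (IwasawaAlgebra 2) P)
      (τ : P →ₛₗ[((IwasawaAlgebra.involEquiv 2).toRingEquiv : IwasawaAlgebra 2 →+* IwasawaAlgebra 2)] D.X)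
      (π : D.X →ₗ[IwasawaAlgebra 2] Y.X),
      (∀ m ∈ M, τ m = 0) ∧ Function.Surjective π ∧ Function.Exact τ π ∧
      ∀ G₁ : IwasawaAlgebra 2,
        iwasawaToPowerSeries 2 G₁ = padicLFunction f (unitRoot W 2 : ℚ_[2]) →
          ∃ s : IwasawaAlgebra 2, s ∉ IwasawaAlgebra.augIdealP 2 ∧ s * G₁ ∈ Submodule.map P.subtype M := by
  -- the local group `S := H¹(ker κ, E[2^∞]) ⧸ K₀`, `K₀ := ker res_{v₂}` (conj-stable: ONE prime of `ℚ_∞` above `2`)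
  set res₂ : W.subgroupH1 2 κ.kerSubgroup →+ W.subgroupH1 2 (κ.kerSubgroup ⊓ decomp v₂) :=
    W.resOfLe 2 (inf_le_left : κ.kerSubgroup ⊓ decomp v₂ ≤ κ.kerSubgroup) with hres₂
  let K₀ : AddSubgroup (W.subgroupH1 2 κ.kerSubgroup) := res₂.ker
  have hK₀ : ∀ s, s ∈ K₀ ↔ res₂ s = 0 := fun s => AddMonoidHom.mem_ker
  have hstab : ∀ σ : absoluteGaloisGroup ℚ, K₀ ≤ K₀.comap (W.conjH1 2 κ.kerSubgroup σ) := by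
    intro σ s hs
    rw [AddSubgroup.mem_comap, hK₀]
    exact resOfLe_conjH1_eq_zero_of_isCyclotomic_rat (M := W.geomPrimaryTorsion 2) hκ v₂ hv₂ ((hK₀ s).1 hs) σ
  -- the descended conjugations and the two keys
  let cγ : AddMonoid.End (W.subgroupH1 2 κ.kerSubgroup ⧸ K₀) :=
    QuotientAddGroup.map K₀ K₀ (W.conjH1 2 κ.kerSubgroup γ) (hstab γ)
  let cγ' : AddMonoid.End (W.subgroupH1 2 κ.kerSubgroup ⧸ K₀) :=
    QuotientAddGroup.map K₀ K₀ (W.conjH1 2 κ.kerSubgroup γ⁻¹) (hstab γ⁻¹)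
  have hcγ : ∀ s, cγ (QuotientAddGroup.mk s) = QuotientAddGroup.mk (W.conjH1 2 κ.kerSubgroup γ s) :=
    fun s => QuotientAddGroup.map_mk K₀ K₀ _ (hstab γ) s
  have hcγ' : ∀ s, cγ' (QuotientAddGroup.mk s) = QuotientAddGroup.mk (W.conjH1 2 κ.kerSubgroup γ⁻¹ s) :=
    fun s => QuotientAddGroup.map_mk K₀ K₀ _ (hstab γ⁻¹) s
  let ψ : AddMonoid.End (W.subgroupH1 2 κ.kerSubgroup ⧸ K₀) := cγ - 1
  let ψm : AddMonoid.End (W.subgroupH1 2 κ.kerSubgroup ⧸ K₀) := cγ' - 1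
  have hconj_mul : ∀ (σ τ : absoluteGaloisGroup ℚ) (s : W.subgroupH1 2 κ.kerSubgroup),
      W.conjH1 2 κ.kerSubgroup σ (W.conjH1 2 κ.kerSubgroup τ s) = W.conjH1 2 κ.kerSubgroup (σ * τ) s := by
    intro σ τ s
    rw [W.conjH1_mul_holds 2 κ.kerSubgroup σ τ, AddMonoidHom.comp_apply]
  have hconj_one : ∀ s : W.subgroupH1 2 κ.kerSubgroup, W.conjH1 2 κ.kerSubgroup 1 s = s := by
    intro s
    rw [W.conjH1_one_holds 2 κ.kerSubgroup, AddMonoidHom.id_apply]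
  have hψ₁ : (1 + ψm) * (1 + ψ) = 1 := by
    have e1 : (1 + ψm) = cγ' := add_sub_cancel 1 cγ'
    have e2 : (1 + ψ) = cγ := add_sub_cancel 1 cγ
    rw [e1, e2]
    apply QuotientAddGroup.addMonoidHom_ext
    ext s
    change cγ' (cγ (QuotientAddGroup.mk s)) = QuotientAddGroup.mk s
    rw [hcγ, hcγ', hconj_mul, inv_mul_cancel, hconj_one]
  have hψ₂ : (1 + ψ) * (1 + ψm) = 1 := by
    have e1 : (1 + ψm) = cγ' := add_sub_cancel 1 cγ'
    have e2 : (1 + ψ) = cγ := add_sub_cancel 1 cγ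
    rw [e1, e2]
    apply QuotientAddGroup.addMonoidHom_ext
    ext s
    change cγ (cγ' (QuotientAddGroup.mk s)) = QuotientAddGroup.mk s
    rw [hcγ', hcγ, hconj_mul, mul_inv_cancel, hconj_one]
  -- `φ := (mod K₀) ∘ (Sel ↪ H¹)`
  let φ : W.selmerInfty κ →+ W.subgroupH1 2 κ.kerSubgroup ⧸ K₀ :=
    (QuotientAddGroup.mk' K₀).comp (W.selmerInfty κ).subtype
  have hφapply : ∀ s : W.selmerInfty κ, φ s = QuotientAddGroup.mk (s : W.subgroupH1 2 κ.kerSubgroup) := fun s => rfl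
  have hφ : ∀ s, φ ((W.conjSelmerInfty κ γ - 1) s) = ψ (φ s) := by
    intro s
    have hcoe : ((((W.conjSelmerInfty κ γ - 1) s : W.selmerInfty κ)) : W.subgroupH1 2 κ.kerSubgroup) =
        W.conjH1 2 κ.kerSubgroup γ s - (s : W.subgroupH1 2 κ.kerSubgroup) := rfl
    rw [hφapply, hφapply, hcoe, QuotientAddGroup.mk_sub]
    change _ = cγ (QuotientAddGroup.mk (s : W.subgroupH1 2 κ.kerSubgroup)) -
      QuotientAddGroup.mk (s : W.subgroupH1 2 κ.kerSubgroup)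
    rw [hcγ]
  have hφ₁ : ∀ s : W.selmerInfty κ, φ s = 0 ↔ res₂ (s : W.subgroupH1 2 κ.kerSubgroup) = 0 := by
    intro s
    rw [hφapply, QuotientAddGroup.eq_zero_iff, hK₀]
  -- the descended pairing `P₀ → Hom(S, ℚ/ℤ)`
  have hKle : ∀ x : P₀, K₀ ≤ (toDualP x).ker := fun x s hs => by
    rw [AddMonoidHom.mem_ker]
    exact hK x s ((hK₀ s).1 hs)
  let toDualP' : P₀ →+ (W.subgroupH1 2 κ.kerSubgroup ⧸ K₀ →+ AddCircle (1 : ℚ)) :=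
    { toFun := fun x => QuotientAddGroup.lift K₀ (toDualP x) (hKle x)
      map_zero' := by
        apply QuotientAddGroup.addMonoidHom_ext
        ext s
        rw [AddMonoidHom.comp_apply, AddMonoidHom.comp_apply, QuotientAddGroup.mk'_apply, QuotientAddGroup.lift_mk,
          map_zero, AddMonoidHom.zero_apply, AddMonoidHom.zero_apply]
      map_add' := fun x y => by
        apply QuotientAddGroup.addMonoidHom_ext
        ext s
        rw [AddMonoidHom.comp_apply, AddMonoidHom.comp_apply, QuotientAddGroup.mk'_apply, QuotientAddGroup.lift_mk,
          map_add, AddMonoidHom.add_apply, AddMonoidHom.add_apply, QuotientAddGroup.lift_mk,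
          QuotientAddGroup.lift_mk] }
  have hlift : ∀ (x : P₀) (s : W.subgroupH1 2 κ.kerSubgroup),
      toDualP' x (QuotientAddGroup.mk s) = toDualP x s := fun x s => QuotientAddGroup.lift_mk K₀ (hKle x) s
  have hT' : ∀ (x : P₀) (t : W.subgroupH1 2 κ.kerSubgroup ⧸ K₀),
      toDualP' ((PowerSeries.X : IwasawaAlgebra 2) • x) t = toDualP' x (ψm t) := by
    intro x t
    obtain ⟨s, rfl⟩ := QuotientAddGroup.mk_surjective t
    change toDualP' ((PowerSeries.X : IwasawaAlgebra 2) • x) (QuotientAddGroup.mk s) =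
      toDualP' x (cγ' (QuotientAddGroup.mk s) - QuotientAddGroup.mk s)
    rw [hcγ', map_sub, hlift, hlift, hlift, hT]
  have hC' : ∀ (c : ℤ_[2]) (x : P₀) (t : W.subgroupH1 2 κ.kerSubgroup ⧸ K₀) (k : ℕ), 2 ^ k • t = 0 →
      toDualP' (PowerSeries.C c • x) t = (PadicInt.toZModPow k c).val • toDualP' x t := by
    intro c x t k hkt
    obtain ⟨s, rfl⟩ := QuotientAddGroup.mk_surjective t
    have hval : 2 ^ k • toDualP x s = 0 := by
      rw [← hlift, ← map_nsmul, hkt, map_zero]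
    rw [hlift, hlift]
    exact hC c x s k hval
  have hsurj' : Function.Surjective toDualP' := by
    intro χ'
    obtain ⟨x, hx⟩ := hS (χ'.comp (QuotientAddGroup.mk' K₀)) (fun s hs => by
      rw [AddMonoidHom.comp_apply, QuotientAddGroup.mk'_apply, (QuotientAddGroup.eq_zero_iff s).2 ((hK₀ s).2 hs),
        map_zero])
    refine ⟨x, ?_⟩
    apply QuotientAddGroup.addMonoidHom_ext
    ext s
    rw [AddMonoidHom.comp_apply, QuotientAddGroup.mk'_apply, hlift, hx, AddMonoidHom.comp_apply,
      QuotientAddGroup.mk'_apply]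
  have hcolφ' : ∀ x : P₀, col x = 0 → ∀ s : W.selmerInfty κ, toDualP' x (φ s) = 0 := by
    intro x hx s
    rw [hφapply, hlift]
    exact hcolφ x hx s
  have hrec' : ∀ s : W.selmerInfty κ, toDualP' x₀ (φ s) = 0 := by
    intro s
    rw [hφapply, hlift]
    exact hrec s
  exact colemanMuSpanFree_invol_datum_of_adjointPairing_erl D Y ψm ψ hψ₁ hψ₂ toDualP' hT' hC' hsurj' col φ hφ
    (hφker_of_kernel_at_one_place_two hκ v₂ hv₂ φ hφ₁) hcolφ' x₀ hrec' herl

end PerDatum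

/-! ## §3 The two typed inputs on Kato's carriers, `0 < Δ` cell ⇒ P⁺ BY NAME -/

/-- **P⁺ = `ColemanMuSpanFreeIotaPosDiscAtTwo` BY NAME from the two typed inputs on Kato's carriers.**
`hpairPT` (W1+W3; classical at every `p`; VERBATIM the first hypothesis of w3's `zetaColemanMuIotaNegDiscAtTwo_of_katoCarriers`,
p720644): for every `W` good ordinary at `2`, cyclotomic `(κ, γ)`, every `v₂ ∋ 2`, normalised local generator `γᵥ` and ALL pinned
carriers `I, J, J′`, a pairing `toDualP : J.H → Hom(H¹(ker κ, E[2^∞]), ℚ/ℤ)` with (K)(T)(C)(S), (I) `range(𝐇¹_{loc,Γ}(F⁺T)) ⊥ Sel`,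
(R) `loc(𝐇¹_Γ) ⊥ Sel`. `hcolHalfPos` (W2⁺, the reading on `0 < Δ`; = p720644's `hcolERL` with `W.Δ < 0 ↦ 0 < W.Δ` and the
genuineness conjunct dropped): a `Λ`-linear `col : J.H → Λ` with `ker col ≤ range(J′ → J)` and ONE global class `y ∈ 𝐇¹_Γ` with
`col (loc y) = u·M·L′`, `M ∉ (2)`, `ι L′ = C r·L₂(f, α)`, `‖r‖₂ = 1` (print witness: Kato's Coleman map and the HALF class
`y′ = Cor z̃_{γ⁺}/2` of a rectangular period lattice — triage Thm E/F, lead F-27a ÷ 2; a global Iwasawa class, NOT an Euler-system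
class: no genuine class has a `μ`-free value there, p691215). READING NOTE: `col` may be rescaled inside the text, so W2⁺'s content
is «an ordinary-kernel functional + ONE global class with a `μ`-free value», under Poitou–Tate a consequence of `μ(X(W/ℚ_∞)) = 0` on
the cell. Proof: `T₂W`-instances, the carriers `v₂, γᵥ, J, J′, I` (they exist), both inputs there, §2 with `P₀ := J.H`, `x₀ := loc y`.
[cite: Kato2004Asterisque, Thm 12.5 (1) (p. 221), Thm 12.6 (p. 222), (14.9.3) (p. 240), Thm 16.6 (2) (p. 271), Prop 17.11, Lemma 17.12 (pp. 277–279), §17.13 (pp. 279–280)]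
[cite: MilneADT2006, Ch. I, Cor. 2.3 and Thm. 4.10] [cite: GreenbergLNM1716, Conj. 1.11 (p. 64), §2 (pp. 69–74)] -/
theorem colemanMuSpanFreeIotaPosDiscAtTwo_of_katoCarriers
    (hpairPT : ∀ (W : WeierstrassCurve ℚ) [W.IsElliptic] [W.IsGloballyMinimal]
      [ContinuousSMul ℤ_[2] (W.tateModule 2)] [Module.Free ℤ_[2] (W.tateModule 2)] [Module.Finite ℤ_[2] (W.tateModule 2)]
      (κ : ZpExtension ℚ 2) (γ : absoluteGaloisGroup ℚ) (_hκ : κ.IsCyclotomic) (hγ : κ.IsTopGenerator γ),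
      IsOrdinaryAt W 2 →
      ∀ (v₂ : HeightOneSpectrum (𝓞 ℚ)) (_ : ((2 : ℕ) : 𝓞 ℚ) ∈ v₂.asIdeal)
        (γᵥ : absoluteGaloisGroup (v₂.adicCompletion ℚ))
        (hsurj : Function.Surjective
          (κ.toContinuousMonoidHom.comp (resGalOfEmb (closureEmb (K := ℚ) (v₂.adicCompletion ℚ)))))
        (hγᵥ : κ.IsTopGenerator (resGalOfEmb (closureEmb (K := ℚ) (v₂.adicCompletion ℚ)) γᵥ))
        (I : IwasawaH1Data W 2 κ γ) (J : LocalIwasawaH1Data κ v₂ ((tateRep W 2).toLocal v₂) γᵥ)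
        (J' : LocalIwasawaH1Data κ v₂ (tateLocalOrdinaryRep W 2 v₂) γᵥ),
      ∃ toDualP : J.H →+ (W.subgroupH1 2 κ.kerSubgroup →+ AddCircle (1 : ℚ)),
        (∀ (x : J.H) (s : W.subgroupH1 2 κ.kerSubgroup),
          W.resOfLe 2 (inf_le_left : κ.kerSubgroup ⊓ decomp v₂ ≤ κ.kerSubgroup) s = 0 → toDualP x s = 0) ∧
        (∀ (x : J.H) (s : W.subgroupH1 2 κ.kerSubgroup),
          toDualP ((PowerSeries.X : IwasawaAlgebra 2) • x) s =
            toDualP x (W.conjH1 2 κ.kerSubgroup γ⁻¹ s) - toDualP x s) ∧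
        (∀ (c : ℤ_[2]) (x : J.H) (s : W.subgroupH1 2 κ.kerSubgroup) (k : ℕ), 2 ^ k • toDualP x s = 0 →
          toDualP (PowerSeries.C c • x) s = (PadicInt.toZModPow k c).val • toDualP x s) ∧
        (∀ χ : W.subgroupH1 2 κ.kerSubgroup →+ AddCircle (1 : ℚ),
          (∀ s, W.resOfLe 2 (inf_le_left : κ.kerSubgroup ⊓ decomp v₂ ≤ κ.kerSubgroup) s = 0 → χ s = 0) →
            ∃ x : J.H, toDualP x = χ) ∧
        (∀ (y : J'.H) (s : W.selmerInfty κ), toDualP (J'.ordinaryInclusion J y) s = 0) ∧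
        (∀ (g : I.H) (s : W.selmerInfty κ), toDualP (I.loc J hsurj hγ hγᵥ g) s = 0))
    (hcolHalfPos : ∀ (W : WeierstrassCurve ℚ) [W.IsElliptic] [W.IsGloballyMinimal]
      [ContinuousSMul ℤ_[2] (W.tateModule 2)] [Module.Free ℤ_[2] (W.tateModule 2)] [Module.Finite ℤ_[2] (W.tateModule 2)]
      {N : ℕ} [NeZero N] (f : CuspForm (Gamma0 N) 2)
      (κ : ZpExtension ℚ 2) (γ : absoluteGaloisGroup ℚ) (hκ : κ.IsCyclotomic) (hγ : κ.IsTopGenerator γ),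
      0 < W.Δ → IsOrdinaryAt W 2 → W.HasSurjectiveModNGaloisRep 2 → IsCyclotomicVariable 2 γ → IsNewformOf W f →
      ∀ (v₂ : HeightOneSpectrum (𝓞 ℚ)) (_ : ((2 : ℕ) : 𝓞 ℚ) ∈ v₂.asIdeal)
        (γᵥ : absoluteGaloisGroup (v₂.adicCompletion ℚ))
        (hsurj : Function.Surjective
          (κ.toContinuousMonoidHom.comp (resGalOfEmb (closureEmb (K := ℚ) (v₂.adicCompletion ℚ)))))
        (hγᵥ : κ.IsTopGenerator (resGalOfEmb (closureEmb (K := ℚ) (v₂.adicCompletion ℚ)) γᵥ))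
        (I : IwasawaH1Data W 2 κ γ) (J : LocalIwasawaH1Data κ v₂ ((tateRep W 2).toLocal v₂) γᵥ)
        (J' : LocalIwasawaH1Data κ v₂ (tateLocalOrdinaryRep W 2 v₂) γᵥ),
      ∃ col : J.H →ₗ[IwasawaAlgebra 2] IwasawaAlgebra 2,
        (∀ x : J.H, col x = 0 → x ∈ LinearMap.range (J'.ordinaryInclusion J)) ∧
        ∃ (y : I.H) (u : (IwasawaAlgebra 2)ˣ) (M L' : IwasawaAlgebra 2) (r : ℚ_[2]),
            M ∉ IwasawaAlgebra.augIdealP 2 ∧ ‖r‖ = 1 ∧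
              iwasawaToPowerSeries 2 L' = PowerSeries.C r * padicLFunction f (unitRoot W 2 : ℚ_[2]) ∧
              col (I.loc J hsurj hγ hγᵥ y) = (u : IwasawaAlgebra 2) * M * L') :
    ColemanMuSpanFreeIotaPosDiscAtTwo := by
  intro W _ _ N _ f κ γ hκ hord h2 hΔ hγ hγ' hf D Y
  haveI : ContinuousSMul ℤ_[2] (W.tateModule 2) := TateModule.continuousSMul_padicInt
  haveI : Module.Free ℤ_[2] (W.tateModule 2) := W.module_free_tateModule_holds 2
  haveI : Module.Finite ℤ_[2] (W.tateModule 2) := W.module_finite_tateModule_holds 2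
  -- the carriers: the place above `2`, a normalised local generator, the pinned local modules, the pinned global module
  obtain ⟨v₂, hv₂⟩ : ∃ v : HeightOneSpectrum (𝓞 ℚ), ((2 : ℕ) : 𝓞 ℚ) ∈ v.asIdeal :=
    ⟨(Rat.HeightOneSpectrum.primesEquiv (R := 𝓞 ℚ)).symm ⟨2, Nat.prime_two⟩,
      (natCast_mem_asIdeal_iff_eq_primesEquiv_symm _ Nat.prime_two).mpr rfl⟩
  obtain ⟨γᵥ, hγᵥ⟩ := hκ.exists_isTopGenerator_resGalOfEmb_adicCompletion v₂ hv₂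
  have hsurj := surjective_comp_resGalOfEmb_of_isCyclotomic (κ := κ) (v := v₂) hκ hv₂
  obtain ⟨J⟩ := nonempty_localIwasawaH1Data κ v₂ ((tateRep W 2).toLocal v₂) γᵥ
  obtain ⟨J'⟩ := nonempty_localIwasawaH1Data κ v₂ (tateLocalOrdinaryRep W 2 v₂) γᵥ
  obtain ⟨I⟩ := nonempty_iwasawaH1Data_holds W 2 κ γ hκ hγ
  -- the two inputs at these carriers
  obtain ⟨toDualP, hK, hT, hC, hS, hiso, hPT⟩ := hpairPT W κ γ hκ hγ hord v₂ hv₂ γᵥ hsurj hγᵥ I J J'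
  obtain ⟨col, hker, y, u, M, L', r, hM, hr, hL', hcol⟩ :=
    hcolHalfPos W f κ γ hκ hγ hΔ hord h2 hγ' hf v₂ hv₂ γᵥ hsurj hγᵥ I J J'
  -- isotropy of `ker col`: it lies in the ordinary part, which pairs to zero with `Sel`
  have hcolφ : ∀ x : J.H, col x = 0 → ∀ s : W.selmerInfty κ, toDualP x s = 0 := by
    intro x hx s
    obtain ⟨y', rfl⟩ := hker x hx
    exact hiso y' s
  exact colemanMuSpanFree_invol_datum_of_locPairing_erl hκ D Y v₂ hv₂ toDualP hK hT hC hS col hcolφ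
    (I.loc J hsurj hγ hγᵥ y) (fun s => hPT y s) ⟨u, M, L', r, hM, hr, hL', hcol⟩

end Summit.BirchSwinnertonDyer.BirchSwinnertonDyer.Theorems.SteinbergFibreAtTwo

end
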